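import Literature.NumberTheory.EllipticCurves.PeriodLatticeGamma1QuotientProofs
import HarnessLib

/-!
# The Shimura quotient `Λ₀(f)/Λ₁(f)` is a quotient of `(ℤ/uv)ˣ/{±1}` for EVERY factorisation `N = u²v`
# (cuspidal inertia: the parabolic at the cusp `1/u` has `d ≡ 1 (mod uv)`), and its first consequences
Summit `BirchSwinnertonDyer`, route `ManinLocalTwoThree` (cell bsd-f2-manin), cruxes C2 `ManinOddAtFour`
(stmt-BirchSwinnertonDyer-22967) / C3 `ManinPrimeToThreeAtNine` (stmt-BirchSwinnertonDyer-22968); lead p1 gen 15.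
Route-independent (imports Literature only).  `Λ₀(f) = periodLattice f`, `Λ₁(f) = periodLatticeGamma1 f`,
`{∞, γ∞}_f = cuspSymbol f γ`, `d_γ` = lower-right entry.

WHAT WAS KNOWN (tree, `Literature/…/PeriodLatticeGamma1QuotientProofs.lean`): the class of `{∞, γ∞}_f` modulo `Λ₁(f)`
depends only on `± d_γ mod N`, so `Λ₀/Λ₁` is a quotient of `(ℤ/N)ˣ/{±1}`; cyclic with `≤ 2` classes at `N = 4q`.
NEW HERE (LEVEL REDUCTION).  For every factorisation `N = u²·v` (`u ≥ 1`) and every integer `t`, the matrix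
`ρ_t = (1 − tuv, tv; −tN, 1 + tuv) ∈ Γ₀(N)` is parabolic and fixes the cusp `1/u`, so `{∞, ρ_t∞}_f = 0`
(Manin relation), while `d_{ρ_t} = 1 + t·uv` (`exists_parabolic_of_sq_mul`; the tree had the case `u = p`,
`…ManinAdditive/ShimuraIndexAtkinLehnerProofs.exists_parabolic`).  HENCE the class of `{∞, γ∞}_f` mod `Λ₁(f)`
depends only on `± d_γ mod uv`: **`Λ₀(f)/Λ₁(f)` is a quotient of `(ℤ/uv)ˣ/{±1}`** — best with `u = ∏ p^⌊e_p/2⌋`,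
`uv = ∏ p^⌈e_p/2⌉` (the conductor of the Shimura covering group is the "square root" of the level, as in
Ling–Oesterlé's structure theorem for `Σ(N)`; here in period-lattice form, elementary).
* §1 `exists_parabolic_of_sq_mul`;
* §2 `cuspSymbol_mem_periodLatticeGamma1_of_apply_eq_one_mod` / `…_neg_one_mod` / `cuspSymbol_sub_mem_…_of_apply_eq_mod`
  (`d_γ ≡ ±1`, `d_γ ≡ d_δ (mod uv)`);
* §3 `natCast_mul_cuspSymbol_mem_…_of_pow_apply_mod`, `totient_mul_mem_periodLatticeGamma1_mod` (`φ(uv)·Λ₀ ⊆ Λ₁`),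
  **`periodLatticeGamma1_eq_of_natMul_mem_of_coprime_totient`**: if `pΛ₀ ⊆ Λ₁` (e.g. `p` traceless, `p² ∣ N`) and
  `p ∤ φ(uv)` then `Λ₁(f) = Λ₀(f)` — at `9 ∣ N`: `N = 9M` with `3 ∤ φ(3M)` (no prime `q ≡ 1 (mod 3)` divides `M`,
  `9 ∤ M`), e.g. `N = 9p`, `p ≡ 2 (mod 3)`, `N = 45, 90, 99, 153` (es census E15: all index `1` ✓);
* §4 `exists_gamma0_apply_one_one_eq_mod` (every unit mod `uv` is a `d_γ`), `exists_eq_natCast_mul_cuspSymbol_add_of_generator_mod`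
  (units of `ℤ/uv` are `± u₀^k` ⟹ `Λ₀ = ℤ·{∞, γ₀∞} + Λ₁`, CYCLIC), `mem_or_sub_mem_…_of_generator_mod_of_two_mul_le`;
* SEQUEL `Theorems/ManinLocalTwoThreeShimuraQuotientLevelInstances.lean`: index `4` (`Λ₁ = 2Λ₀`, E-an-152b) EXCLUDED at
  `N = u²v` with `uv = 4q` (`8p, 16p, …`), `(ℤ/uv)ˣ` cyclic, `uv ∈ {8, 16}` (`N = 32, 64, 128, 256`); `Λ₁ = Λ₀` at `N = 9M`,
  `3 ∤ φ(3M)`.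
HONEST FRAMING: unconditional structure theorems; E-an-152b stays OPEN at the levels where `(ℤ/uv)ˣ/⟨−1⟩` has `2`-rank
`≥ 2` (`N = 2^e M`, `M` odd squarefree: `e ≥ 5 ∧ ω(M) ≥ 1`, `e ∈ {3,4} ∧ ω(M) ≥ 2`, `e = 2 ∧ (ω(M) ≥ 3 ∨ q ≡ r ≡ 1 (4))`);
C2, C3, Manin's conjecture and BSD are NOT proved by this file.  No definitions, no sorry.
[cite: Manin1972, Prop. 1.4 / Thm. 1.6 (the period homomorphism; parabolic elements have zero period)]
[cite: LingOesterle1991, §1 and Thm. 1 (structure of the Shimura subgroup Σ(N) — the printed shadow of the level reduction)]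
[cite: Stevens1989, §2 (the Shimura covering E₁ → E₀ and its kernel Λ₀(f)/Λ₁(f))]
-/

set_option autoImplicit false
-- the summit-side namespace `Summit.BirchSwinnertonDyer.BirchSwinnertonDyer.…` is the tree's (summit = sub-problem)
set_option linter.dupNamespace false

noncomputable section

open scoped MatrixGroups ModularForm

open CongruenceSubgroup WeierstrassCurve Literature.NumberTheory.EllipticCurves
  Literature.NumberTheory.EllipticCurves.ModularForms

namespace Summit.BirchSwinnertonDyer.BirchSwinnertonDyer.Theorems.ManinLocalTwoThree

variable {N : ℕ} [NeZero N] (f : CuspForm (Gamma0 N) 2)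

/-! ## §1 The parabolic at the cusp `1/u` -/

/-- **The parabolic at `1/u`.**  For `N = u²v` and `t ∈ ℤ` the matrix `ρ_t = (1 − tuv, tv; −tN, 1 + tuv)` lies in
`Γ₀(N)`, fixes the cusp `1/u`, hence has zero period `{∞, ρ_t∞}_f = 0` (Manin relation `{∞, ρ r} = {∞, ρ∞} + {∞, r}`
at `r = 1/u = ρ_t(1/u)`), and `d_{ρ_t} = 1 + t·uv`. [cite: Manin1972, Prop. 1.4 / Thm. 1.6] -/
theorem exists_parabolic_of_sq_mul {u v : ℕ} (hu : u ≠ 0) (hN : (N : ℤ) = (u : ℤ) ^ 2 * v) (t : ℤ) :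
    ∃ ρ : Gamma0 N, cuspSymbol f ρ = 0 ∧ (((ρ : SL(2, ℤ)) 1 1 : ℤ) = 1 + (u : ℤ) * v * t) := by
  let M : SL(2, ℤ) := ⟨!![1 - (u : ℤ) * v * t, (v : ℤ) * t; -((u : ℤ) ^ 2 * v * t), 1 + (u : ℤ) * v * t], by
    rw [Matrix.det_fin_two_of]; ring⟩
  have hM : M ∈ Gamma0 N := by
    rw [Gamma0_mem]
    simp only [M, Matrix.of_apply, Matrix.cons_val', Matrix.cons_val_zero, Matrix.cons_val_one,
      Matrix.cons_val_fin_one]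
    have hN0 : ((N : ℤ) : ZMod N) = 0 := by simp
    rw [hN] at hN0
    push_cast at hN0 ⊢
    linear_combination (-(t : ZMod N)) * hN0
  refine ⟨⟨M, hM⟩, ?_, ?_⟩
  · have hu' : (u : ℚ) ≠ 0 := by exact_mod_cast hu
    have hden : (-((u : ℚ) ^ 2 * v * t)) * (1 / u) + (1 + u * v * t) = 1 := by field_simp; ring
    have hr : ((((⟨M, hM⟩ : Gamma0 N) : SL(2, ℤ)) 1 0 : ℤ) : ℚ) * (1 / u) +
        ((((⟨M, hM⟩ : Gamma0 N) : SL(2, ℤ)) 1 1 : ℤ) : ℚ) ≠ 0 := by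
      simp only [M, Matrix.of_apply, Matrix.cons_val', Matrix.cons_val_zero, Matrix.cons_val_one,
        Matrix.cons_val_fin_one]
      push_cast
      rw [hden]; exact one_ne_zero
    have key := modularSymbol_gamma0_smul_holds f ⟨M, hM⟩ (1 / u) hr
    have harg : ((((⟨M, hM⟩ : Gamma0 N) : SL(2, ℤ)) 0 0 : ℤ) : ℚ) * (1 / u) +
        ((((⟨M, hM⟩ : Gamma0 N) : SL(2, ℤ)) 0 1 : ℤ) : ℚ) = 1 / u := by
      simp only [M, Matrix.of_apply, Matrix.cons_val', Matrix.cons_val_zero, Matrix.cons_val_one,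
        Matrix.cons_val_fin_one]
      push_cast
      field_simp; ring
    have hden' : ((((⟨M, hM⟩ : Gamma0 N) : SL(2, ℤ)) 1 0 : ℤ) : ℚ) * (1 / u) +
        ((((⟨M, hM⟩ : Gamma0 N) : SL(2, ℤ)) 1 1 : ℤ) : ℚ) = 1 := by
      simp only [M, Matrix.of_apply, Matrix.cons_val', Matrix.cons_val_zero, Matrix.cons_val_one,
        Matrix.cons_val_fin_one]
      push_cast
      exact hden
    rw [harg, hden', div_one] at key
    linear_combination -key
  · simp only [M, Matrix.of_apply, Matrix.cons_val', Matrix.cons_val_one, Matrix.cons_val_fin_one]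

/-! ## §2 The class of `{∞, γ∞}_f` modulo `Λ₁(f)` depends only on `± d_γ mod uv` -/

omit [NeZero N] in
/-- `uv ∣ N` when `N = u²v`. -/
theorem mul_dvd_of_sq_mul {u v : ℕ} (hN : (N : ℤ) = (u : ℤ) ^ 2 * v) : u * v ∣ N := by
  have hN' : N = u ^ 2 * v := by exact_mod_cast hN
  exact ⟨u, by rw [hN']; ring⟩

/-- The lower-right entry of `γ ∈ Γ₀(N)` read modulo `uv` is a unit (`N = u²v`). -/
theorem isUnit_apply_one_one_mod {u v : ℕ} (hN : (N : ℤ) = (u : ℤ) ^ 2 * v) (γ : Gamma0 N) :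
    IsUnit ((((γ : SL(2, ℤ)) 1 1 : ℤ) : ZMod (u * v))) := by
  have h := (isUnit_apply_one_one γ).map (ZMod.castHom (mul_dvd_of_sq_mul hN) (ZMod (u * v)))
  rwa [map_intCast] at h

/-- **`d_γ ≡ 1 (mod uv) ⇒ {∞, γ∞}_f ∈ Λ₁(f)`** (`N = u²v`): `d_γ = 1 + t·uv = d_{ρ_t}` for the parabolic `ρ_t` of §1,
so `{∞, γ∞}_f ≡ {∞, ρ_t∞}_f = 0 (mod Λ₁(f))`. [cite: Manin1972, Prop. 1.4 / Thm. 1.6] [cite: LingOesterle1991, §1] -/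
theorem cuspSymbol_mem_periodLatticeGamma1_of_apply_eq_one_mod {u v : ℕ} (hu : u ≠ 0)
    (hN : (N : ℤ) = (u : ℤ) ^ 2 * v) (γ : Gamma0 N)
    (hd : ((((γ : SL(2, ℤ)) 1 1 : ℤ)) : ZMod (u * v)) = 1) :
    cuspSymbol f γ ∈ periodLatticeGamma1 f := by
  have hdvd : ((u * v : ℕ) : ℤ) ∣ ((γ : SL(2, ℤ)) 1 1 : ℤ) - 1 :=
    (ZMod.intCast_eq_intCast_iff_dvd_sub 1 _ (u * v)).mp (by rw [hd]; simp)
  obtain ⟨t, ht⟩ := hdvd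
  obtain ⟨ρ, hρ0, hρ11⟩ := exists_parabolic_of_sq_mul f hu hN t
  have hdt : ((γ : SL(2, ℤ)) 1 1 : ℤ) = 1 + (u : ℤ) * v * t := by push_cast at ht; linarith
  have h := cuspSymbol_sub_mem_periodLatticeGamma1_of_apply_eq f ρ γ (by rw [hρ11, hdt])
  rwa [hρ0, sub_zero] at h

/-- **`d_γ ≡ −1 (mod uv) ⇒ {∞, γ∞}_f ∈ Λ₁(f)`** (`−γ` has the same period). [cite: Manin1972, Prop. 1.4 / Thm. 1.6] -/
theorem cuspSymbol_mem_periodLatticeGamma1_of_apply_eq_neg_one_mod {u v : ℕ} (hu : u ≠ 0)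
    (hN : (N : ℤ) = (u : ℤ) ^ 2 * v) (γ : Gamma0 N)
    (hd : ((((γ : SL(2, ℤ)) 1 1 : ℤ)) : ZMod (u * v)) = -1) :
    cuspSymbol f γ ∈ periodLatticeGamma1 f := by
  obtain ⟨δ, -, -, h11, hδ⟩ := exists_neg_entries_cuspSymbol_eq f γ
  rw [← hδ]
  exact cuspSymbol_mem_periodLatticeGamma1_of_apply_eq_one_mod f hu hN δ
    (by rw [h11, Int.cast_neg, hd, neg_neg])

omit [NeZero N] in
/-- The lower-right entry of `γ⁻¹δ` is `≡ a_γ d_δ ≡ 1 (mod uv)` when `d_γ ≡ d_δ (mod uv)` (`uv ∣ N ∣ c_γ`, `a_γ d_γ ≡ 1`). -/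
theorem apply_one_one_inv_mul_eq_one_mod {u v : ℕ} (hN : (N : ℤ) = (u : ℤ) ^ 2 * v) (γ δ : Gamma0 N)
    (hd : ((((γ : SL(2, ℤ)) 1 1 : ℤ)) : ZMod (u * v)) = (((δ : SL(2, ℤ)) 1 1 : ℤ) : ZMod (u * v))) :
    (((((γ⁻¹ * δ : Gamma0 N)) : SL(2, ℤ)) 1 1 : ℤ) : ZMod (u * v)) = 1 := by
  have e11 : ((((γ⁻¹ * δ : Gamma0 N)) : SL(2, ℤ)) 1 1 : ℤ) =
      -((γ : SL(2, ℤ)) 1 0) * (δ : SL(2, ℤ)) 0 1 + (γ : SL(2, ℤ)) 0 0 * (δ : SL(2, ℤ)) 1 1 := by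
    rw [Subgroup.coe_mul, Subgroup.coe_inv, Matrix.SpecialLinearGroup.SL2_inv_expl,
      Matrix.SpecialLinearGroup.coe_mul]
    simp [Matrix.mul_apply, Fin.sum_univ_two]
  have hc : ((((γ : SL(2, ℤ)) 1 0 : ℤ)) : ZMod (u * v)) = 0 := by
    have h := congrArg (ZMod.castHom (mul_dvd_of_sq_mul hN) (ZMod (u * v))) (Gamma0_mem.mp γ.2)
    rwa [map_intCast, map_zero] at h
  have hdet : ((γ : SL(2, ℤ)) : Matrix (Fin 2) (Fin 2) ℤ).det = 1 := (γ : SL(2, ℤ)).2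
  rw [Matrix.det_fin_two] at hdet
  have had : ((((γ : SL(2, ℤ)) 0 0 : ℤ)) : ZMod (u * v)) * (((γ : SL(2, ℤ)) 1 1 : ℤ) : ZMod (u * v)) = 1 := by
    have h' := congrArg (fun x : ℤ ↦ (x : ZMod (u * v))) hdet
    simp only [Int.cast_sub, Int.cast_mul, Int.cast_one, hc, mul_zero, sub_zero] at h'
    exact h'
  rw [e11]; push_cast; rw [hc, ← hd]; linear_combination had

/-- **`d_γ ≡ d_δ (mod uv) ⇒ {∞, δ∞}_f − {∞, γ∞}_f ∈ Λ₁(f)`** (`N = u²v`): THE LEVEL REDUCTION — the period character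
`Γ₀(N) → Λ₀(f)/Λ₁(f)` factors through `γ ↦ d_γ mod uv`, i.e. `Λ₀(f)/Λ₁(f)` is a quotient of `(ℤ/uv)ˣ/{±1}`.
[cite: LingOesterle1991, §1 and Thm. 1] [cite: Manin1972, Prop. 1.4 / Thm. 1.6] -/
theorem cuspSymbol_sub_mem_periodLatticeGamma1_of_apply_eq_mod {u v : ℕ} (hu : u ≠ 0)
    (hN : (N : ℤ) = (u : ℤ) ^ 2 * v) (γ δ : Gamma0 N)
    (hd : ((((γ : SL(2, ℤ)) 1 1 : ℤ)) : ZMod (u * v)) = (((δ : SL(2, ℤ)) 1 1 : ℤ) : ZMod (u * v))) :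
    cuspSymbol f δ - cuspSymbol f γ ∈ periodLatticeGamma1 f := by
  have hmul := cuspSymbol_mul_holds f γ (γ⁻¹ * δ)
  rw [mul_inv_cancel_left] at hmul
  have e : cuspSymbol f δ - cuspSymbol f γ = cuspSymbol f (γ⁻¹ * δ) := by rw [hmul]; ring
  rw [e]
  exact cuspSymbol_mem_periodLatticeGamma1_of_apply_eq_one_mod f hu hN _
    (apply_one_one_inv_mul_eq_one_mod hN γ δ hd)

/-- … and when `d_δ ≡ −d_γ (mod uv)`. [cite: LingOesterle1991, §1] -/
theorem cuspSymbol_sub_mem_periodLatticeGamma1_of_apply_eq_neg_mod {u v : ℕ} (hu : u ≠ 0)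
    (hN : (N : ℤ) = (u : ℤ) ^ 2 * v) (γ δ : Gamma0 N)
    (hd : ((((δ : SL(2, ℤ)) 1 1 : ℤ)) : ZMod (u * v)) = -(((γ : SL(2, ℤ)) 1 1 : ℤ) : ZMod (u * v))) :
    cuspSymbol f δ - cuspSymbol f γ ∈ periodLatticeGamma1 f := by
  obtain ⟨γ', -, -, h11, hγ'⟩ := exists_neg_entries_cuspSymbol_eq f γ
  rw [← hγ']
  exact cuspSymbol_sub_mem_periodLatticeGamma1_of_apply_eq_mod f hu hN γ' δ (by rw [h11, Int.cast_neg, hd])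

/-! ## §3 Exponent: `φ(uv)·Λ₀(f) ⊆ Λ₁(f)`; the coprime-exponent collapse `Λ₁(f) = Λ₀(f)` -/

omit [NeZero N] in
/-- `d_{γ^k} ≡ d_γ^k (mod uv)` (`uv ∣ N`). -/
theorem apply_one_one_pow_eq_mod {u v : ℕ} (hN : (N : ℤ) = (u : ℤ) ^ 2 * v) (γ : Gamma0 N) (n : ℕ) :
    ((((γ ^ n : Gamma0 N) : SL(2, ℤ)) 1 1 : ℤ) : ZMod (u * v)) = (((γ : SL(2, ℤ)) 1 1 : ℤ) : ZMod (u * v)) ^ n := by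
  have h := congrArg (ZMod.castHom (mul_dvd_of_sq_mul hN) (ZMod (u * v))) (apply_one_one_pow_eq γ n)
  rwa [map_intCast, map_pow, map_intCast] at h

/-- **`d_γ^k ≡ ±1 (mod uv) ⇒ k·{∞, γ∞}_f ∈ Λ₁(f)`** (`N = u²v`). [cite: LingOesterle1991, §1] -/
theorem natCast_mul_cuspSymbol_mem_periodLatticeGamma1_of_pow_apply_mod {u v : ℕ} (hu : u ≠ 0)
    (hN : (N : ℤ) = (u : ℤ) ^ 2 * v) (γ : Gamma0 N) (k : ℕ)
    (hk : (((γ : SL(2, ℤ)) 1 1 : ℤ) : ZMod (u * v)) ^ k = 1 ∨ (((γ : SL(2, ℤ)) 1 1 : ℤ) : ZMod (u * v)) ^ k = -1) :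
    (k : ℂ) * cuspSymbol f γ ∈ periodLatticeGamma1 f := by
  rw [← cuspSymbol_pow_eq_natCast_mul]
  rcases hk with h | h
  · exact cuspSymbol_mem_periodLatticeGamma1_of_apply_eq_one_mod f hu hN _ (by rw [apply_one_one_pow_eq_mod hN, h])
  · exact cuspSymbol_mem_periodLatticeGamma1_of_apply_eq_neg_one_mod f hu hN _
      (by rw [apply_one_one_pow_eq_mod hN, h])

/-- **`φ(uv)·{∞, γ∞}_f ∈ Λ₁(f)`** (`N = u²v`; Euler `d_γ^{φ(uv)} ≡ 1 (mod uv)`). [cite: LingOesterle1991, §1 and Thm. 1] -/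
theorem totient_mul_cuspSymbol_mem_periodLatticeGamma1_mod {u v : ℕ} (hu : u ≠ 0)
    (hN : (N : ℤ) = (u : ℤ) ^ 2 * v) (γ : Gamma0 N) :
    (Nat.totient (u * v) : ℂ) * cuspSymbol f γ ∈ periodLatticeGamma1 f := by
  refine natCast_mul_cuspSymbol_mem_periodLatticeGamma1_of_pow_apply_mod f hu hN γ _ (Or.inl ?_)
  rw [← IsUnit.unit_spec (isUnit_apply_one_one_mod hN γ), ← Units.val_pow_eq_pow_val, ZMod.pow_totient,
    Units.val_one]

/-- **`φ(uv)·Λ₀(f) ⊆ Λ₁(f)`**: the Shimura quotient is killed by `φ(uv)`, the exponent of `(ℤ/uv)ˣ` (`N = u²v`).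
[cite: LingOesterle1991, §1 and Thm. 1] -/
theorem totient_mul_mem_periodLatticeGamma1_mod {u v : ℕ} (hu : u ≠ 0) (hN : (N : ℤ) = (u : ℤ) ^ 2 * v)
    {z : ℂ} (hz : z ∈ periodLattice f) : (Nat.totient (u * v) : ℂ) * z ∈ periodLatticeGamma1 f := by
  have hz' : z ∈ (periodLattice f : Set ℂ) := hz
  rw [coe_periodLattice_eq_range] at hz'
  obtain ⟨γ, rfl⟩ := hz'
  exact totient_mul_cuspSymbol_mem_periodLatticeGamma1_mod f hu hN γ

/-- **COPRIME-EXPONENT COLLAPSE.**  If `p·Λ₀(f) ⊆ Λ₁(f)` for a natural number `p` (e.g. a traceless prime `p`, `p² ∣ N`,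
tree `pMulLatticeLeGamma1OfTracelessPrime_holds`) and `p` is prime to `φ(uv)` for some factorisation `N = u²v`, then
`Λ₁(f) = Λ₀(f)` (Bézout: `z = a·(pz) + b·(φ(uv)z)`).  At `9 ∣ N = 9M`: `3 ∤ φ(3M)` ⟺ `9 ∤ M` and no prime `q ≡ 1 (mod 3)`
divides `M` — e.g. `N = 9p` with `p ≡ 2 (mod 3)`, `N = 18, 45, 90, 99, 153`. [cite: LingOesterle1991, Thm. 1 and Thm. 6] -/
theorem periodLatticeGamma1_eq_of_natMul_mem_of_coprime_totient {u v : ℕ} (hu : u ≠ 0)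
    (hN : (N : ℤ) = (u : ℤ) ^ 2 * v) {p : ℕ} (hp : ∀ z ∈ periodLattice f, (p : ℂ) * z ∈ periodLatticeGamma1 f)
    (hcop : Nat.Coprime p (Nat.totient (u * v))) : periodLatticeGamma1 f = periodLattice f := by
  refine le_antisymm (periodLatticeGamma1_le_periodLattice f) fun z hz ↦ ?_
  obtain ⟨a, b, hab⟩ := Nat.isCoprime_iff_coprime.mpr hcop
  have h1 : (((a * p + b * (Nat.totient (u * v)) : ℤ)) : ℂ) = 1 := by rw [hab]; simp
  push_cast at h1
  have key : z = (a : ℂ) * ((p : ℂ) * z) + (b : ℂ) * ((Nat.totient (u * v) : ℂ) * z) := by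
    linear_combination -z * h1
  rw [key]
  have ha := (periodLatticeGamma1 f).zsmul_mem (hp z hz) a
  have hb := (periodLatticeGamma1 f).zsmul_mem (totient_mul_mem_periodLatticeGamma1_mod f hu hN hz) b
  rw [zsmul_eq_mul] at ha hb
  exact add_mem ha hb

/-! ## §4 Cyclicity at modulus `uv` -/

/-- **Every unit of `ℤ/uv` is `d_γ mod uv` for some `γ ∈ Γ₀(N)`** (`N = u²v`: a residue prime to `uv` is prime to `N`,
then Bézout as in `exists_gamma0_apply_one_one_eq_of_isUnit`). [cite: DiamondShurman2005, §1.2] -/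
theorem exists_gamma0_apply_one_one_eq_mod {u v : ℕ} (hN : (N : ℤ) = (u : ℤ) ^ 2 * v) {a : ZMod (u * v)}
    (ha : IsUnit a) : ∃ γ : Gamma0 N, (((γ : SL(2, ℤ)) 1 1 : ℤ) : ZMod (u * v)) = a := by
  have hN' : N = u * (u * v) := by
    have h : N = u ^ 2 * v := by exact_mod_cast hN
    rw [h]; ring
  haveI : NeZero (u * v) := ⟨fun h ↦ NeZero.ne N (by rw [hN', h, mul_zero])⟩
  have hcop : Nat.Coprime a.val (u * v) := by
    rw [← ZMod.isUnit_iff_coprime, ZMod.natCast_zmod_val]; exact ha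
  have hcopN : Nat.Coprime a.val N := by
    rw [hN']
    exact Nat.Coprime.mul_right (Nat.Coprime.coprime_dvd_right (dvd_mul_right u v) hcop) hcop
  have hunit : IsUnit ((a.val : ℕ) : ZMod N) := (ZMod.isUnit_iff_coprime _ _).mpr hcopN
  obtain ⟨γ, hγ⟩ := exists_gamma0_apply_one_one_eq_of_isUnit hunit
  refine ⟨γ, ?_⟩
  have h := congrArg (ZMod.castHom (mul_dvd_of_sq_mul hN) (ZMod (u * v))) hγ
  rw [map_intCast, map_natCast, ZMod.natCast_zmod_val] at h
  exact h

/-- **If the units of `ℤ/uv` are the `± u₀^k` and `d_{γ₀} ≡ u₀ (mod uv)`, then `Λ₀(f) = ℤ·{∞, γ₀∞}_f + Λ₁(f)`** (`N = u²v`):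
the Shimura quotient is CYCLIC, generated by one period.  Applies whenever `(ℤ/uv)ˣ/{±1}` is cyclic: `uv = 4q^j`
(`q` odd), `uv = q^j, 2q^j`, `uv ∈ {4, 8, 16}`. [cite: LingOesterle1991, §1 and Thm. 1] [cite: Stevens1989, §2] -/
theorem exists_eq_natCast_mul_cuspSymbol_add_of_generator_mod {u v : ℕ} (hu : u ≠ 0)
    (hN : (N : ℤ) = (u : ℤ) ^ 2 * v) {u₀ : ZMod (u * v)}
    (hgen : ∀ w : (ZMod (u * v))ˣ, ∃ k : ℕ, (w : ZMod (u * v)) = u₀ ^ k ∨ (w : ZMod (u * v)) = -(u₀ ^ k))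
    (γ₀ : Gamma0 N) (hγ₀ : (((γ₀ : SL(2, ℤ)) 1 1 : ℤ) : ZMod (u * v)) = u₀) {z : ℂ} (hz : z ∈ periodLattice f) :
    ∃ (k : ℕ) (w : ℂ), w ∈ periodLatticeGamma1 f ∧ z = k * cuspSymbol f γ₀ + w := by
  have hz' : z ∈ (periodLattice f : Set ℂ) := hz
  rw [coe_periodLattice_eq_range] at hz'
  obtain ⟨γ, rfl⟩ := hz'
  obtain ⟨k, hk⟩ := hgen (isUnit_apply_one_one_mod hN γ).unit
  rw [IsUnit.unit_spec] at hk
  refine ⟨k, cuspSymbol f γ - cuspSymbol f (γ₀ ^ k), ?_, by rw [cuspSymbol_pow_eq_natCast_mul]; ring⟩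
  rcases hk with h | h
  · exact cuspSymbol_sub_mem_periodLatticeGamma1_of_apply_eq_mod f hu hN _ _
      (by rw [apply_one_one_pow_eq_mod hN, hγ₀, h])
  · exact cuspSymbol_sub_mem_periodLatticeGamma1_of_apply_eq_neg_mod f hu hN _ _
      (by rw [apply_one_one_pow_eq_mod hN, hγ₀, h])

/-- **Cyclic Shimura quotient killed by `2` has at most two classes** (modulus-`uv` form): under the generator hypothesis at
`uv`, if `2Λ₀(f) ⊆ Λ₁(f)` then every `z ∈ Λ₀(f)` is `≡ 0` or `≡ {∞, γ₀∞}_f (mod Λ₁(f))`.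
[cite: LingOesterle1991, §1 and Thm. 6] [cite: Stevens1989, §2] -/
theorem mem_or_sub_mem_periodLatticeGamma1_of_generator_mod_of_two_mul_le {u v : ℕ} (hu : u ≠ 0)
    (hN : (N : ℤ) = (u : ℤ) ^ 2 * v) {u₀ : ZMod (u * v)}
    (hgen : ∀ w : (ZMod (u * v))ˣ, ∃ k : ℕ, (w : ZMod (u * v)) = u₀ ^ k ∨ (w : ZMod (u * v)) = -(u₀ ^ k))
    (γ₀ : Gamma0 N) (hγ₀ : (((γ₀ : SL(2, ℤ)) 1 1 : ℤ) : ZMod (u * v)) = u₀)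
    (h2 : ∀ z ∈ periodLattice f, (2 : ℂ) * z ∈ periodLatticeGamma1 f) {z : ℂ} (hz : z ∈ periodLattice f) :
    z ∈ periodLatticeGamma1 f ∨ z - cuspSymbol f γ₀ ∈ periodLatticeGamma1 f := by
  obtain ⟨k, w, hw, rfl⟩ := exists_eq_natCast_mul_cuspSymbol_add_of_generator_mod f hu hN hgen γ₀ hγ₀ hz
  have h2γ : (2 : ℂ) * cuspSymbol f γ₀ ∈ periodLatticeGamma1 f := h2 _ (cuspSymbol_mem_periodLattice f γ₀)
  have hm : ((k / 2 : ℕ) : ℂ) * ((2 : ℂ) * cuspSymbol f γ₀) ∈ periodLatticeGamma1 f := by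
    rw [← nsmul_eq_mul]
    exact (periodLatticeGamma1 f).nsmul_mem h2γ _
  rcases Nat.even_or_odd k with ⟨m, hm2⟩ | ⟨m, hm2⟩
  · left
    have hk : (k : ℂ) * cuspSymbol f γ₀ = ((k / 2 : ℕ) : ℂ) * ((2 : ℂ) * cuspSymbol f γ₀) := by
      rw [hm2, show (m + m) / 2 = m by omega]
      push_cast
      ring
    rw [hk]
    exact add_mem hm hw
  · right
    have hk : (k : ℂ) * cuspSymbol f γ₀ + w - cuspSymbol f γ₀ =
        ((k / 2 : ℕ) : ℂ) * ((2 : ℂ) * cuspSymbol f γ₀) + w := by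
      rw [hm2, show (2 * m + 1) / 2 = m by omega]
      push_cast
      ring
    rw [hk]
    exact add_mem hm hw

/-- **Packaged: generator hypothesis at `uv` + `2Λ₀ ⊆ Λ₁` ⟹ at most two classes**, with the generating `γ₀` produced
(`exists_gamma0_apply_one_one_eq_mod`). [cite: LingOesterle1991, §1 and Thm. 6] -/
theorem exists_forall_mem_or_sub_mem_periodLatticeGamma1_of_generator_mod {u v : ℕ} (hu : u ≠ 0)
    (hN : (N : ℤ) = (u : ℤ) ^ 2 * v) {u₀ : ZMod (u * v)} (hu₀ : IsUnit u₀)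
    (hgen : ∀ w : (ZMod (u * v))ˣ, ∃ k : ℕ, (w : ZMod (u * v)) = u₀ ^ k ∨ (w : ZMod (u * v)) = -(u₀ ^ k))
    (h2 : ∀ z ∈ periodLattice f, (2 : ℂ) * z ∈ periodLatticeGamma1 f) :
    ∃ γ₀ : Gamma0 N, ∀ z ∈ periodLattice f,
      z ∈ periodLatticeGamma1 f ∨ z - cuspSymbol f γ₀ ∈ periodLatticeGamma1 f := by
  obtain ⟨γ₀, hγ₀⟩ := exists_gamma0_apply_one_one_eq_mod hN hu₀
  exact ⟨γ₀, fun z hz ↦ mem_or_sub_mem_periodLatticeGamma1_of_generator_mod_of_two_mul_le f hu hN hgen γ₀ hγ₀ h2 hz⟩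

/-- **A cyclic unit group is generated up to sign** (trivially, with the `+` sign): if `(ℤ/m)ˣ` is cyclic then its
elements are the `u₀^k` for a generator `u₀`. [cite: DiamondShurman2005, §1.2] -/
theorem exists_forall_units_eq_pow_or_eq_neg_pow_of_isCyclic {m : ℕ} [NeZero m] [IsCyclic (ZMod m)ˣ] :
    ∃ u₀ : ZMod m, IsUnit u₀ ∧ ∀ w : (ZMod m)ˣ, ∃ k : ℕ, (w : ZMod m) = u₀ ^ k ∨ (w : ZMod m) = -(u₀ ^ k) := by
  obtain ⟨g, hg⟩ := IsCyclic.exists_generator (α := (ZMod m)ˣ)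
  refine ⟨(g : ZMod m), Units.isUnit g, fun w ↦ ?_⟩
  have hw : w ∈ Subgroup.zpowers g := hg w
  rw [← mem_powers_iff_mem_zpowers, Submonoid.mem_powers_iff] at hw
  obtain ⟨k, hk⟩ := hw
  refine ⟨k, Or.inl ?_⟩
  have h := congrArg Units.val hk
  rw [Units.val_pow_eq_pow_val] at h
  exact h.symm

/-- **The units of `ℤ/8` are `± 3^k`** (`1, 3, 7 = −1, 5 = −3`). [folklore] -/
theorem forall_units_zmod_eight : ∀ w : (ZMod 8)ˣ, ∃ k : ℕ, (w : ZMod 8) = 3 ^ k ∨ (w : ZMod 8) = -(3 ^ k) := by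
  have key : ∀ x y : ZMod 8, x * y = 1 → x = 3 ^ 0 ∨ x = 3 ^ 1 ∨ x = -(3 ^ 0) ∨ x = -(3 ^ 1) := by decide
  intro w
  obtain ⟨y, hy⟩ := (Units.isUnit w).exists_right_inv
  rcases key _ _ hy with h | h | h | h
  · exact ⟨0, Or.inl h⟩
  · exact ⟨1, Or.inl h⟩
  · exact ⟨0, Or.inr h⟩
  · exact ⟨1, Or.inr h⟩

/-- **The units of `ℤ/16` are `± 3^k`** (`3` has order `4`: `1, 3, 9, 11` and their negatives). [folklore] -/
theorem forall_units_zmod_sixteen :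
    ∀ w : (ZMod 16)ˣ, ∃ k : ℕ, (w : ZMod 16) = 3 ^ k ∨ (w : ZMod 16) = -(3 ^ k) := by
  have key : ∀ x y : ZMod 16, x * y = 1 → x = 3 ^ 0 ∨ x = 3 ^ 1 ∨ x = 3 ^ 2 ∨ x = 3 ^ 3 ∨
      x = -(3 ^ 0) ∨ x = -(3 ^ 1) ∨ x = -(3 ^ 2) ∨ x = -(3 ^ 3) := by decide
  intro w
  obtain ⟨y, hy⟩ := (Units.isUnit w).exists_right_inv
  rcases key _ _ hy with h | h | h | h | h | h | h | h
  · exact ⟨0, Or.inl h⟩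
  · exact ⟨1, Or.inl h⟩
  · exact ⟨2, Or.inl h⟩
  · exact ⟨3, Or.inl h⟩
  · exact ⟨0, Or.inr h⟩
  · exact ⟨1, Or.inr h⟩
  · exact ⟨2, Or.inr h⟩
  · exact ⟨3, Or.inr h⟩

end Summit.BirchSwinnertonDyer.BirchSwinnertonDyer.Theorems.ManinLocalTwoThree

end
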